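import Mathlib.LinearAlgebra.Matrix.Nondegenerate
import Mathlib.Tactic.FieldSimp
import HarnessLib

/-!
# The `n`-sheet matrix: monomial `σ`-intertwiners, the zero case, and the nonsingular case (any `n ≥ 1`)

COR-CM (cell `pub-hodgecm2`), binder seat b04 (gen 26), count-neutral claim CYCLIC-SEMIDIRECT-RESIDUE, part Q-Ib′ — the order-`n`
form of `CorCM/FourSheetMatrix` (`n = 4`), groundwork for the `2^j`-sheet programme (Galois groups `C_p ⋊_{2^j} C_{2^m}`): pure
`n × n` linear algebra over a field `L` with a ring endomorphism `σ`.  KERNEL ONLY: theorems; no definition, no named fact, no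
`sorry`.  `HC_CM` is neither used nor claimed.

THE MATRIX.  For `δ < n`, sheet sums `s_0, …, s_{n−1} ∈ L` with `σ^n(s_j) = s_j` and a `σ`-fixed unit `ω`,
  `M^{(δ)}_{ik} = ω^{[i + j ≥ n]} · σ^k(s_j)`, `j = (k + δ − i) mod n` (`i, k < n`).
With the cyclic shift `Π` (`Π_{i,i+1} = 1`), `C_δ = diag(ω at k = n − 1 − δ, else 1)`, `R = diag(1, …, 1, ω⁻¹)`:
  `M P = P' σ(M)`, `P = Π⁻¹ C_δ⁻¹`, `P' = Π⁻¹ R`; `σ(P) = P` and `P^n = ω⁻¹ · 1`.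

* `iterate_mod_apply_of_fixed` — `σ^a(x) = σ^{a mod n}(x)` when `σ^n(x) = x`.
* **`sheet_mul_eq_mul_map`** — `M P = P' σ(M)`.
* `sheetP_map_eq`, `sheetP_pow_apply`, **`sheetP_pow_eq`** — `σ(P) = P`, the powers of `P`, `P^n = ω⁻¹ • 1`.
* `sheetSum_eq_zero_of_sheet_eq_zero` — `M = 0 ⟹ s_j = 0` for all `j < n`.
* `apply_eq_zero_of_sheet_det_ne_zero` — the sum-form system is `M u = 0`; `det M ≠ 0 ⟹ u = 0`.

## References

* [Pierce1982] R. S. Pierce, *Associative Algebras*, GTM 88, Springer 1982, §15.1 (cyclic algebras).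
* [Kubota1965] T. Kubota, Nagoya Math. J. 25 (1965) 113–120, §4 Lemma 2.

Provenance: Literature home (family `hodge`, namespace `Literature.LinearAlgebra.CyclicSheet`) of the Summits-side `CorCM/CyclicSheetMatrix` (cell `pub-hodgecm2`, COR-CM; all its imports are `Literature/` and Mathlib), which `Literature/` may not import; theorems only, no named fact, no definition. Nothing here bears on `HC_CM`. Lane `lit-hodgefound` (Layer A3: CM types, their Kubota ranks and Galois combinatorics), seat p20.
-/

open scoped BigOperators

namespace Literature.LinearAlgebra.CyclicSheet

section Iterate

variable {α : Type*}

/-- `σ^a(x) = σ^{a mod n}(x)` when `σ^n(x) = x`. [cite: Pierce1982, §15.1] -/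
theorem iterate_mod_apply_of_fixed (σ : α → α) {n : ℕ} {x : α} (hfix : σ^[n] x = x) (a : ℕ) :
    σ^[a] x = σ^[a % n] x := by
  conv_lhs => rw [← Nat.mod_add_div a n, Function.iterate_add_apply, Function.iterate_mul,
    Function.iterate_fixed hfix]

end Iterate

section MatrixN

variable {L : Type*} [Field L] {n : ℕ}

/-- **The `n`-sheet matrix is intertwined with its `σ`-conjugate by monomial matrices: `M P = P' σ(M)`.**
[cite: Pierce1982, §15.1] -/
theorem sheet_mul_eq_mul_map (hn : 0 < n) (σ : L →+* L) (ω : L) (hω : ω ≠ 0) (hσω : σ ω = ω) (s : ℕ → L)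
    (hσn : ∀ j, σ^[n] (s j) = s j) (δ : ℕ) (hδ : δ < n) (M P P' : Matrix (Fin n) (Fin n) L)
    (hM : ∀ i k : Fin n, M i k = (if (i : ℕ) + (((k : ℕ) + δ + n - i) % n) < n then 1 else ω) *
      σ^[k] (s (((k : ℕ) + δ + n - i) % n)))
    (hP : ∀ i k : Fin n, P i k =
      if (i : ℕ) = ((k : ℕ) + 1) % n then (if (k : ℕ) = n - 1 - δ then ω⁻¹ else 1) else 0)
    (hP' : ∀ i k : Fin n, P' i k =
      if (i : ℕ) = ((k : ℕ) + 1) % n then (if (k : ℕ) = n - 1 then ω⁻¹ else 1) else 0) :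
    M * P = P' * M.map σ := by
  ext i k
  have hi := i.isLt
  have hk := k.isLt
  -- the single nonzero term on each side
  set l₀ : Fin n := ⟨((k : ℕ) + 1) % n, Nat.mod_lt _ hn⟩ with hl₀_def
  set l₁ : Fin n := ⟨((i : ℕ) + n - 1) % n, Nat.mod_lt _ hn⟩ with hl₁_def
  have hl₁' : (i : ℕ) = ((l₁ : ℕ) + 1) % n := by
    rcases Nat.eq_zero_or_pos (i : ℕ) with h0 | hpos
    · rw [hl₁_def]
      simp only [h0, zero_add]
      rw [Nat.mod_eq_of_lt (by omega : n - 1 < n), Nat.sub_add_cancel hn, Nat.mod_self]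
    · rw [hl₁_def]
      simp only
      rw [show (i : ℕ) + n - 1 = ((i : ℕ) - 1) + n by omega, Nat.add_mod_right,
        Nat.mod_eq_of_lt (by omega : (i : ℕ) - 1 < n), Nat.sub_add_cancel hpos, Nat.mod_eq_of_lt hi]
  have hLHS : (M * P) i k = M i l₀ * (if (k : ℕ) = n - 1 - δ then ω⁻¹ else 1) := by
    rw [Matrix.mul_apply, Finset.sum_eq_single l₀]
    · rw [hP]
      simp [hl₀_def]
    · intro l _ hl
      rw [hP]
      have : (l : ℕ) ≠ ((k : ℕ) + 1) % n := fun h => hl (Fin.ext (by rw [hl₀_def]; exact h))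
      simp [this]
    · intro h; exact absurd (Finset.mem_univ _) h
  have hRHS : (P' * M.map σ) i k = (if (l₁ : ℕ) = n - 1 then ω⁻¹ else 1) * σ (M l₁ k) := by
    rw [Matrix.mul_apply, Finset.sum_eq_single l₁]
    · rw [hP', Matrix.map_apply]
      simp [← hl₁']
    · intro l _ hl
      rw [hP']
      have : (i : ℕ) ≠ ((l : ℕ) + 1) % n := by
        intro h
        apply hl
        apply Fin.ext
        -- `l ≡ i − 1 ≡ l₁ (mod n)`
        have hl2 := l.isLt
        have e1 : ((l : ℕ) + 1) % n = ((l₁ : ℕ) + 1) % n := by rw [← h, ← hl₁']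
        have e2 : ((l : ℕ) + 1 + (n - 1)) % n = ((l₁ : ℕ) + 1 + (n - 1)) % n := by
          rw [Nat.add_mod, e1, ← Nat.add_mod]
        rw [show (l : ℕ) + 1 + (n - 1) = (l : ℕ) + n by omega, show (l₁ : ℕ) + 1 + (n - 1) = (l₁ : ℕ) + n by omega,
          Nat.add_mod_right, Nat.add_mod_right, Nat.mod_eq_of_lt hl2, Nat.mod_eq_of_lt l₁.isLt] at e2
        exact e2
      simp [this]
    · intro h; exact absurd (Finset.mem_univ _) h
  rw [hLHS, hRHS, hM, hM, map_mul]
  -- the common sheet index `J`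
  set J : ℕ := ((k : ℕ) + 1 + δ + n - i) % n with hJ_def
  have hJlt : J < n := Nat.mod_lt _ hn
  have hJ0 : ((l₀ : ℕ) + δ + n - i) % n = J := by
    rw [hl₀_def, hJ_def]
    simp only
    rw [show ((k : ℕ) + 1) % n + δ + n - i = ((k : ℕ) + 1) % n + (δ + n - i) by omega,
      show (k : ℕ) + 1 + δ + n - i = ((k : ℕ) + 1) + (δ + n - i) by omega, Nat.add_mod, Nat.mod_mod, ← Nat.add_mod]
  -- the iterates: `σ^{(k+1) mod n} = σ^{k+1}` on `s J`
  have hit0 : σ^[(l₀ : ℕ)] (s J) = σ (σ^[k] (s J)) := by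
    rw [hl₀_def]
    simp only
    rw [← iterate_mod_apply_of_fixed σ (hσn J), Function.iterate_succ_apply']
  have hσε : ∀ c : Prop, ∀ [Decidable c], σ (if c then 1 else ω) = if c then 1 else ω := by
    intro c _; split_ifs <;> simp [hσω]
  rcases Nat.eq_zero_or_pos (i : ℕ) with h0 | hpos
  · -- row `i = 0`: `l₁ = n − 1`
    have hl₁v : (l₁ : ℕ) = n - 1 := by
      rw [hl₁_def]; simp only [h0, zero_add]; rw [Nat.mod_eq_of_lt (by omega : n - 1 < n)]
    have hJ1 : ((k : ℕ) + δ + n - l₁) % n = J := by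
      rw [hl₁v, hJ_def, h0, show (k : ℕ) + δ + n - (n - 1) = (k : ℕ) + 1 + δ by omega,
        show (k : ℕ) + 1 + δ + n - 0 = (k : ℕ) + 1 + δ + n by omega, Nat.add_mod_right]
    rw [hJ0, hJ1, hit0, hσε, hl₁v, h0]
    simp only [zero_add, if_pos hJlt, one_mul, if_true]
    -- `k = n − 1 − δ ↔ J = 0 ↔ n − 1 + J < n`
    by_cases hkδ : (k : ℕ) = n - 1 - δ
    · have hJz : J = 0 := by
        rw [hJ_def, h0, hkδ, show n - 1 - δ + 1 + δ + n - 0 = n + n by omega, Nat.add_mod_right, Nat.mod_self]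
      rw [if_pos hkδ, hJz, if_pos (by omega)]
      ring
    · have hJnz : J ≠ 0 := by
        rw [hJ_def, h0, show (k : ℕ) + 1 + δ + n - 0 = ((k : ℕ) + 1 + δ) + n by omega, Nat.add_mod_right]
        intro hz
        have hlt2 : (k : ℕ) + 1 + δ < 2 * n := by omega
        have hge : n ≤ (k : ℕ) + 1 + δ := by
          by_contra hlt
          rw [Nat.mod_eq_of_lt (by omega)] at hz
          omega
        have : ((k : ℕ) + 1 + δ) % n = (k : ℕ) + 1 + δ - n := by
          rw [show (k : ℕ) + 1 + δ = ((k : ℕ) + 1 + δ - n) + n by omega, Nat.add_mod_right, Nat.mod_eq_of_lt (by omega)]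
          omega
        omega
      rw [if_neg hkδ, if_neg (by omega)]
      field_simp
  · -- row `i ≥ 1`: `l₁ = i − 1`
    have hl₁v : (l₁ : ℕ) = (i : ℕ) - 1 := by
      rw [hl₁_def]; simp only
      rw [show (i : ℕ) + n - 1 = ((i : ℕ) - 1) + n by omega, Nat.add_mod_right, Nat.mod_eq_of_lt (by omega)]
    have hJ1 : ((k : ℕ) + δ + n - l₁) % n = J := by
      rw [hl₁v, hJ_def, show (k : ℕ) + δ + n - ((i : ℕ) - 1) = (k : ℕ) + 1 + δ + n - i by omega]
    have hl₁n : (l₁ : ℕ) ≠ n - 1 := by rw [hl₁v]; omega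
    rw [hJ0, hJ1, hit0, hσε, if_neg hl₁n, one_mul, hl₁v]
    -- `k = n − 1 − δ ↔ i + J = n`
    have hkey : (k : ℕ) = n - 1 - δ ↔ (i : ℕ) + J = n := by
      rw [hJ_def]
      constructor
      · intro hk2
        rw [hk2, show n - 1 - δ + 1 + δ + n - (i : ℕ) = (n - (i : ℕ)) + n by omega, Nat.add_mod_right,
          Nat.mod_eq_of_lt (by omega)]
        omega
      · intro hsum
        -- `(k+1+δ+n-i) % n = n - i`, so `k+1+δ ≡ 0 (mod n)`, `k+1+δ ∈ [1, 2n)`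
        have hx : ((k : ℕ) + 1 + δ + n - i) % n = n - i := by omega
        have hrange : (k : ℕ) + 1 + δ + n - i < 3 * n := by omega
        by_contra hne
        -- write `k+1+δ+n-i = (n - i) + (k+1+δ)`; its residue is `n - i` iff `n ∣ k+1+δ`
        have e : (k : ℕ) + 1 + δ + n - i = (n - i) + ((k : ℕ) + 1 + δ) := by omega
        rw [e, Nat.add_mod] at hx
        rw [Nat.mod_eq_of_lt (by omega : n - (i : ℕ) < n)] at hx
        have hm : ((k : ℕ) + 1 + δ) % n ≠ 0 := by
          intro hz
          have := Nat.dvd_of_mod_eq_zero hz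
          obtain ⟨c, hc⟩ := this
          have hc1 : c = 1 := by
            rcases c with _ | c
            · omega
            · rcases c with _ | c
              · rfl
              · nlinarith
          subst hc1
          omega
        have hlt3 : ((k : ℕ) + 1 + δ) % n < n := Nat.mod_lt _ hn
        -- `(n - i + r) % n = n - i` with `0 < r < n` is impossible
        have hr := hm
        set r := ((k : ℕ) + 1 + δ) % n with hr_def
        by_cases hc : n - (i : ℕ) + r < n
        · rw [Nat.mod_eq_of_lt hc] at hx; omega
        · rw [show n - (i : ℕ) + r = (n - (i : ℕ) + r - n) + n by omega, Nat.add_mod_right,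
            Nat.mod_eq_of_lt (by omega)] at hx
          omega
    by_cases hkδ : (k : ℕ) = n - 1 - δ
    · have hsum := hkey.1 hkδ
      rw [if_pos hkδ, if_neg (by omega), if_pos (by omega)]
      field_simp
    · have hsum : (i : ℕ) + J ≠ n := fun h => hkδ (hkey.2 h)
      rw [if_neg hkδ, mul_one]
      by_cases hlt : (i : ℕ) + J < n
      · rw [if_pos hlt, if_pos (by omega)]
      · rw [if_neg hlt, if_neg (by omega)]

/-- `(a + b % n + c) % n = (a + b + c) % n`. [cite: Pierce1982, §15.1] -/
theorem add_mod_add_mod (a b c n : ℕ) : (a + b % n + c) % n = (a + b + c) % n := by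
  rw [Nat.add_mod (a + b % n) c, Nat.add_mod a (b % n), Nat.mod_mod, ← Nat.add_mod a b, ← Nat.add_mod]

/-- `σ(P) = P`: the monomial matrix has `σ`-fixed entries. [cite: Pierce1982, §15.1] -/
theorem sheetP_map_eq (σ : L →+* L) (ω : L) (hσω : σ ω = ω) (δ : ℕ) (P : Matrix (Fin n) (Fin n) L)
    (hP : ∀ i k : Fin n, P i k =
      if (i : ℕ) = ((k : ℕ) + 1) % n then (if (k : ℕ) = n - 1 - δ then ω⁻¹ else 1) else 0) :
    P.map σ = P := by
  ext i k
  rw [Matrix.map_apply, hP]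
  split_ifs <;> simp [hσω]

/-- `σ(P^t) = P^t`. [cite: Pierce1982, §15.1] -/
theorem sheetP_pow_map_eq (σ : L →+* L) (ω : L) (hσω : σ ω = ω) (δ : ℕ) (P : Matrix (Fin n) (Fin n) L)
    (hP : ∀ i k : Fin n, P i k =
      if (i : ℕ) = ((k : ℕ) + 1) % n then (if (k : ℕ) = n - 1 - δ then ω⁻¹ else 1) else 0) (t : ℕ) :
    (P ^ t).map σ = P ^ t := by
  rw [← RingHom.mapMatrix_apply, map_pow, RingHom.mapMatrix_apply, sheetP_map_eq σ ω hσω δ P hP]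

/-- **The powers of `P`**: `(P^t)_{ik} = [i ≡ k + t] · ∏_{u<t} c_{(k+u) mod n}`, `c_l = ω⁻¹` if `l = n − 1 − δ`, else `1`.
 [cite: Pierce1982, §15.1] -/
theorem sheetP_pow_apply (hn : 0 < n) (ω : L) (δ : ℕ) (P : Matrix (Fin n) (Fin n) L)
    (hP : ∀ i k : Fin n, P i k =
      if (i : ℕ) = ((k : ℕ) + 1) % n then (if (k : ℕ) = n - 1 - δ then ω⁻¹ else 1) else 0) (t : ℕ) (i k : Fin n) :
    (P ^ t) i k = if (i : ℕ) = ((k : ℕ) + t) % n then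
      ∏ u ∈ Finset.range t, (if ((k : ℕ) + u) % n = n - 1 - δ then ω⁻¹ else (1 : L)) else 0 := by
  induction t generalizing i k with
  | zero =>
    rw [pow_zero, Matrix.one_apply, Finset.prod_range_zero, add_zero, Nat.mod_eq_of_lt k.isLt]
    simp only [Fin.ext_iff]
  | succ t ih =>
    rw [pow_succ, Matrix.mul_apply]
    set l₀ : Fin n := ⟨((k : ℕ) + 1) % n, Nat.mod_lt _ hn⟩ with hl₀_def
    rw [Finset.sum_eq_single l₀]
    · rw [ih, hP l₀ k]
      have hl₀v : (l₀ : ℕ) = ((k : ℕ) + 1) % n := rfl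
      rw [if_pos hl₀v, hl₀v]
      set ck : L := (if (k : ℕ) = n - 1 - δ then ω⁻¹ else (1 : L)) with hck
      have e1 : (((k : ℕ) + 1) % n + t) % n = ((k : ℕ) + (t + 1)) % n := by
        rw [Nat.add_mod, Nat.mod_mod, ← Nat.add_mod]; ring_nf
      rw [e1]
      split_ifs with h
      · rw [Finset.prod_range_succ' _ t, add_zero, Nat.mod_eq_of_lt k.isLt, ← hck]
        congr 1
        refine Finset.prod_congr rfl fun u _ => ?_
        rw [show ((k : ℕ) + 1) % n + u = 0 + ((k : ℕ) + 1) % n + u by ring, add_mod_add_mod,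
          show 0 + ((k : ℕ) + 1) + u = (k : ℕ) + (u + 1) by ring]
      · rw [zero_mul]
    · intro l _ hl
      rw [hP l k]
      have : (l : ℕ) ≠ ((k : ℕ) + 1) % n := fun h => hl (Fin.ext h)
      rw [if_neg this, mul_zero]
    · intro h; exact absurd (Finset.mem_univ _) h

/-- **`P^n = ω⁻¹ · 1`.** [cite: Pierce1982, §15.1] -/
theorem sheetP_pow_eq (hn : 0 < n) (ω : L) (δ : ℕ) (hδ : δ < n) (P : Matrix (Fin n) (Fin n) L)
    (hP : ∀ i k : Fin n, P i k =
      if (i : ℕ) = ((k : ℕ) + 1) % n then (if (k : ℕ) = n - 1 - δ then ω⁻¹ else 1) else 0) :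
    P ^ n = ω⁻¹ • (1 : Matrix (Fin n) (Fin n) L) := by
  ext i k
  rw [sheetP_pow_apply hn ω δ P hP, Matrix.smul_apply, Matrix.one_apply, Nat.add_mod_right, Nat.mod_eq_of_lt k.isLt,
    smul_eq_mul]
  have hprod : ∏ u ∈ Finset.range n, (if ((k : ℕ) + u) % n = n - 1 - δ then ω⁻¹ else (1 : L)) = ω⁻¹ := by
    have hk := k.isLt
    rw [Finset.prod_nbij' (fun u => ((k : ℕ) + u) % n) (fun l => (l + n - k) % n)
      (t := Finset.range n) (g := fun l => if l = n - 1 - δ then ω⁻¹ else (1 : L))]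
    · rw [Finset.prod_ite_eq']
      rw [if_pos (Finset.mem_range.2 (by omega))]
    · intro u _; exact Finset.mem_range.2 (Nat.mod_lt _ hn)
    · intro l _; exact Finset.mem_range.2 (Nat.mod_lt _ hn)
    · intro u hu
      rw [Finset.mem_range] at hu
      show (((k : ℕ) + u) % n + n - k) % n = u
      rw [show ((k : ℕ) + u) % n + n - k = 0 + ((k : ℕ) + u) % n + (n - k) by omega, add_mod_add_mod,
        show 0 + ((k : ℕ) + u) + (n - k) = u + n by omega, Nat.add_mod_right, Nat.mod_eq_of_lt hu]
    · intro l hl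
      rw [Finset.mem_range] at hl
      show ((k : ℕ) + (l + n - k) % n) % n = l
      rw [show (k : ℕ) + (l + n - k) % n = (k : ℕ) + (l + n - k) % n + 0 from rfl, add_mod_add_mod,
        show (k : ℕ) + (l + n - k) + 0 = l + n by omega, Nat.add_mod_right, Nat.mod_eq_of_lt hl]
    · intro u _; rfl
  rw [hprod]
  split_ifs with h1 h2 h2
  · rw [mul_one]
  · exact absurd (Fin.ext h1) h2
  · exact absurd (congrArg Fin.val h2) h1
  · rw [mul_zero]

/-- If the `n`-sheet matrix vanishes then all sheet sums vanish (read off the column `k = 0`). [cite: Pierce1982, §15.1] -/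
theorem sheetSum_eq_zero_of_sheet_eq_zero (hn : 0 < n) (σ : L →+* L) (ω : L) (hω : ω ≠ 0) (s : ℕ → L) (δ : ℕ)
    (hδ : δ < n) (M : Matrix (Fin n) (Fin n) L)
    (hM : ∀ i k : Fin n, M i k = (if (i : ℕ) + (((k : ℕ) + δ + n - i) % n) < n then 1 else ω) *
      σ^[k] (s (((k : ℕ) + δ + n - i) % n)))
    (h0 : M = 0) : ∀ j, j < n → s j = 0 := by
  intro j hj
  have hi : (δ + n - j) % n < n := Nat.mod_lt _ hn
  have h := hM ⟨(δ + n - j) % n, hi⟩ ⟨0, hn⟩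
  rw [h0, Matrix.zero_apply] at h
  have hjj : ((0 : ℕ) + δ + n - (δ + n - j) % n) % n = j := by
    by_cases hjδ : j ≤ δ
    · rw [show δ + n - j = (δ - j) + n by omega, Nat.add_mod_right, Nat.mod_eq_of_lt (show δ - j < n by omega),
        show 0 + δ + n - (δ - j) = j + n by omega, Nat.add_mod_right, Nat.mod_eq_of_lt hj]
    · rw [Nat.mod_eq_of_lt (by omega : δ + n - j < n), show 0 + δ + n - (δ + n - j) = j by omega,
        Nat.mod_eq_of_lt hj]
  simp only [hjj, Function.iterate_zero, id_eq] at h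
  rcases mul_eq_zero.1 h.symm with h1 | h1
  · split_ifs at h1 with hlt
    · exact absurd h1 one_ne_zero
    · exact absurd h1 hω
  · exact h1

/-- The `n`-sheet system in sum form is `M^{(δ)} u = 0`; if `det M^{(δ)} ≠ 0` then `u = 0`. [cite: Pierce1982, §15.1] -/
theorem apply_eq_zero_of_sheet_det_ne_zero (hn : 0 < n) (ε : ℕ → ℕ → L) (S : ℕ → ℕ → L) (δ : ℕ) (hδ : δ < n)
    (u : ℕ → L)
    (hsys : ∀ i₀, i₀ < n → ∑ j ∈ Finset.range n, ε i₀ j * S j ((i₀ + j + n - δ) % n) * u ((i₀ + j + n - δ) % n) = 0)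
    (M : Matrix (Fin n) (Fin n) L)
    (hM : ∀ i k : Fin n, M i k = ε i (((k : ℕ) + δ + n - i) % n) * S (((k : ℕ) + δ + n - i) % n) k)
    (hdet : M.det ≠ 0) : ∀ k, k < n → u k = 0 := by
  have hvec : M.mulVec (fun k : Fin n => u k) = 0 := by
    funext i
    have hi := i.isLt
    rw [Matrix.mulVec, Pi.zero_apply]
    change ∑ k : Fin n, M i k * u k = 0
    rw [← hsys i hi]
    refine Finset.sum_nbij' (fun k : Fin n => ((k : ℕ) + δ + n - i) % n)
      (fun j => ⟨(i + j + n - δ) % n, Nat.mod_lt _ hn⟩)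
      (fun k _ => Finset.mem_range.2 (Nat.mod_lt _ hn)) (fun j _ => Finset.mem_univ _)
      (fun k _ => ?_) (fun j hj => ?_) (fun k _ => ?_)
    · have hk := k.isLt
      refine Fin.ext ?_
      simp only
      rw [show (i : ℕ) + ((k : ℕ) + δ + n - i) % n + n - δ = (i : ℕ) + ((k : ℕ) + δ + n - i) % n + (n - δ) by omega,
        add_mod_add_mod, show (i : ℕ) + ((k : ℕ) + δ + n - i) + (n - δ) = k + (n + n) by omega,
        show (k : ℕ) + (n + n) = (k : ℕ) + n + n by ring, Nat.add_mod_right, Nat.add_mod_right, Nat.mod_eq_of_lt hk]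
    · rw [Finset.mem_range] at hj
      simp only
      rw [show ((i : ℕ) + j + n - δ) % n + δ + n - i = 0 + ((i : ℕ) + j + n - δ) % n + (δ + n - i) by omega,
        add_mod_add_mod, show 0 + ((i : ℕ) + j + n - δ) + (δ + n - i) = j + n + n by omega, Nat.add_mod_right,
        Nat.add_mod_right, Nat.mod_eq_of_lt hj]
    · have hk := k.isLt
      have e1 : ((i : ℕ) + (((k : ℕ) + δ + n - i) % n) + n - δ) % n = k := by
        rw [show (i : ℕ) + ((k : ℕ) + δ + n - i) % n + n - δ = (i : ℕ) + ((k : ℕ) + δ + n - i) % n + (n - δ) by omega,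
          add_mod_add_mod, show (i : ℕ) + ((k : ℕ) + δ + n - i) + (n - δ) = k + (n + n) by omega,
          show (k : ℕ) + (n + n) = (k : ℕ) + n + n by ring, Nat.add_mod_right, Nat.add_mod_right, Nat.mod_eq_of_lt hk]
      rw [hM, e1]
  intro k hk
  have h := Matrix.eq_zero_of_mulVec_eq_zero hdet hvec
  exact congrFun h ⟨k, hk⟩

end MatrixN

end Literature.LinearAlgebra.CyclicSheet
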